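import Literature.Geometry.Lorentzian.ParametricAnnulusGluingChart
import Literature.Geometry.Lorentzian.CoordConstraintCongr
import HarnessLib

/-!
# Parametric annular gluing: reassembly of far coordinate families into data on `X`

Topic `Literature/Geometry/Lorentzian`. Everything here is PROVED; no definition, no statement of
`Prop` type is introduced.

Second half of the bookkeeping of the assembly of the named fact
`ChruscielDelay_parametricAnnulusGluing` (`ParametricAnnulusGluing.lean`; Chruściel–Delay 2003,
Thm. 5.9 / Prop. 5.10 / Cor. 5.11 and §8.6) around its coordinate core
(`ParametricAnnulusGluingChart.lean` reads data IN the chart of the end; this file transports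
families of coordinate fields BACK to `X`). Let `e : AFEnd X`, `e.R ≤ R₁ < ρ₁`, and let `(H, HK)` be
coordinate fields on `E3` which beyond radius `R₁` are smooth, symmetric, `H` positive definite:

* `AFEnd.patchData_outerField` — if `(H, HK)` are the chart components of `D₁` on
  `{R₁ < ‖z‖ < ρ₁}`, the outer fields `(coord^* H, coord^* HK)` are patch data for `D₁` with radii
  `(R₁, ρ₁)` (`AFEnd.PatchData`, `AFEndPatch.lean`); the patched datum is `D₁` off `e.far R₁` and
  `coord^*(H, HK)` on it;
* `AFEnd.isVacuumConstraintSolution_patch_outerField` — **the patch of vacuum data by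
  coordinate-vacuum far fields is vacuum** (on the far region the chart components of the patch
  ARE `(H, HK)`, so the chart bridge `isVacuumAt_of_coordVacuum` and the locality of `hamAt`,
  `momFn` apply; elsewhere the patch is locally `D₁`, `isVacuumAt_congr`);
* `AFEnd.contMDiffAt_patchField_outerField_family` — joint smoothness in a parameter of patched
  sections `patchField e R₁ (coord^*(H c)) (s c)` when `(c, z) ↦ H c z` is jointly `C^∞` near the
  far region and agrees with the smooth family of sections `s` on the annulus `{R₁ < ‖coord‖ < ρ₁}`;
* `AFEnd.exists_localGluingFamily_of_farCoordFamily` — **reassembly**: a family `(H c, HK c)`,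
  `c ∈ ball 0 r`, of coordinate fields, jointly `C^∞`, symmetric, positive and coordinate-vacuum on
  `ball 0 r × {R₁ < ‖z‖}`, equal to the chart components of `F c` on `{R₁ < ‖z‖ < ρ₁}`, to those of
  `D = F 0` at `c = 0` and beyond radius `R₂`, is transported back to `X` as a family `G₀` of VACUUM
  initial data sets, jointly smooth on `ball 0 r × X`, through `D`, equal to `F c` off `e.far R₁`
  and to `D` on `e.far R₂` (Chruściel–Delay 2003, Cor. 5.11 / §8.6: the solution on the annulus
  "can be smoothly continued" by the given data on either side).

## References

* P. T. Chruściel, E. Delay, Mém. Soc. Math. Fr. 94 (2003), Cor. 5.11 and §8.6 (pp. 52–54).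
  [ChruscielDelay2003]
* J. Corvino, Comm. Math. Phys. 214 (2000), §4 (patching beyond a sphere). [Corvino2000]
* R. Bartnik, J. Isenberg, *The constraint equations* (2004), §2. [BartnikIsenberg2004]
-/

noncomputable section

set_option maxSynthPendingDepth 3

open Bundle Set Function Filter TopologicalSpace Manifold Module Metric
open scoped Manifold ContDiff Topology

namespace Literature.Geometry.Lorentzian

namespace AFEnd

variable {X : Type} [TopologicalSpace X] [ChartedSpace E3 X] [IsManifold (𝓡 3) ∞ X]

/-! ### Patch data from far coordinate fields -/

/-- **Outer fields of far coordinate fields are patch data.** If `(H, HK)` are `C^∞`, symmetric,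
`H` positive definite at the points of `{R₁ < ‖z‖}` (`e.R ≤ R₁ < ρ₁`), and equal to the chart
components of `D₁` on `{R₁ < ‖z‖ < ρ₁}`, then `(coord^* H, coord^* HK)` are patch data for `D₁`
with radii `(R₁, ρ₁)`. [cite: Corvino2000, §4] -/
theorem patchData_outerField (e : AFEnd X) (D₁ : InitialDataSet (𝓡 3) X) {R₁ ρ₁ : ℝ}
    (hR₁ : e.R ≤ R₁) (h₁ : R₁ < ρ₁) {H HK : E3 → E3 →L[ℝ] E3 →L[ℝ] ℝ}
    (hsm : ∀ z : E3, R₁ < ‖z‖ → ContDiffAt ℝ ∞ H z ∧ ContDiffAt ℝ ∞ HK z)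
    (hsym : ∀ z : E3, R₁ < ‖z‖ → ∀ v w : E3, H z v w = H z w v ∧ HK z v w = HK z w v)
    (hpos : ∀ z : E3, R₁ < ‖z‖ → ∀ v : E3, v ≠ 0 → 0 < H z v v)
    (hin : ∀ z : E3, R₁ < ‖z‖ → ‖z‖ < ρ₁ → H z = hCoeff e D₁ z ∧ HK z = kCoeff e D₁ z) :
    e.PatchData D₁ R₁ ρ₁ (outerField e H) (outerField e HK) := by
  have hsmooth : ∀ {G : E3 → E3 →L[ℝ] E3 →L[ℝ] ℝ}, (∀ z : E3, R₁ < ‖z‖ → ContDiffAt ℝ ∞ G z) →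
      SmoothBilinOn (outerField e G) (e.far R₁) := by
    intro G hG x hx
    obtain ⟨hxU, hxR⟩ := e.mem_far_iff_coord.1 hx
    have hc : ContDiffAt ℝ ∞ (uncurry fun (_ : ℝ) (z : E3) ↦ G z) ((0 : ℝ), e.coord x) :=
      (hG _ hxR).comp ((0 : ℝ), e.coord x) contDiffAt_snd
    have h := e.contMDiffAt_outerField_family_of_contDiffAt (P := ℝ) hxU hc
    have h2 : ContMDiffAt (𝓡 3) (𝓘(ℝ, ℝ).prod (𝓡 3)) ∞ (fun y : X ↦ ((0 : ℝ), y)) x :=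
      contMDiffAt_const.prodMk contMDiffAt_id
    exact (h.comp x h2).contMDiffWithinAt
  refine ⟨hR₁, h₁, hsmooth fun z hz ↦ (hsm z hz).1, hsmooth fun z hz ↦ (hsm z hz).2,
    ?_, ?_, ?_, ?_, ?_⟩
  · intro x hx v w
    obtain ⟨-, hxR⟩ := e.mem_far_iff_coord.1 hx
    rw [outerField_apply, outerField_apply]
    exact (hsym _ hxR _ _).1
  · intro x hx v hv
    obtain ⟨hxU, hxR⟩ := e.mem_far_iff_coord.1 hx
    rw [outerField_apply]
    refine hpos _ hxR _ fun hv0 ↦ hv ?_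
    exact e.injective_mfderiv_coord hxU (hv0.trans (map_zero _).symm)
  · intro x hx v w
    obtain ⟨-, hxR⟩ := e.mem_far_iff_coord.1 hx
    rw [outerField_apply, outerField_apply]
    exact (hsym _ hxR _ _).2
  · intro x hx hlt
    obtain ⟨hxU, hxR⟩ := e.mem_far_iff_coord.1 hx
    exact e.outerField_eq_h_inner D₁ hxU (hin _ hxR hlt).1
  · intro x hx hlt
    obtain ⟨hxU, hxR⟩ := e.mem_far_iff_coord.1 hx
    exact e.outerField_eq_k D₁ hxU (hin _ hxR hlt).2

/-! ### The patch by coordinate-vacuum far fields is vacuum -/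

/-- **The patch of a vacuum datum by coordinate-vacuum outer fields is vacuum.** If `D₁` solves the
vacuum constraints and the far fields `(H, HK)` of the patch data solve the coordinate constraint
equations `hamAt H HK = 0`, `momFn H HK = 0` on `{R₁ < ‖z‖}`, then `e.patch D₁ P` solves the vacuum
constraints: on `e.far R₁` its chart components are `(H, HK)` (`hCoeff_eq_of_h_inner_eq_outerField`)
and the chart bridge applies (`isVacuumAt_of_coordVacuum`, locality of `hamAt`/`momFn`); off
`e.far R₁` it is locally `D₁`. [cite: BartnikIsenberg2004, §2] -/
theorem isVacuumConstraintSolution_patch_outerField (e : AFEnd X) (D₁ : InitialDataSet (𝓡 3) X)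
    {R₁ ρ₁ : ℝ} {H HK : E3 → E3 →L[ℝ] E3 →L[ℝ] ℝ}
    (P : e.PatchData D₁ R₁ ρ₁ (outerField e H) (outerField e HK)) {ι : Type*} [Fintype ι]
    (b : Basis ι ℝ E3)
    (hcv : ∀ z : E3, R₁ < ‖z‖ →
      MetricCoord.hamAt H HK z = 0 ∧ ∀ Z : E3, MetricCoord.momFn b H HK z Z = 0)
    (hD₁ : ∀ [D₁.metric.HasLeviCivita], D₁.IsVacuumConstraintSolution)
    [(e.patch D₁ P).metric.HasLeviCivita] : (e.patch D₁ P).IsVacuumConstraintSolution := by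
  intro x
  by_cases hx : x ∈ e.far R₁
  · obtain ⟨hxU, hxR⟩ := e.mem_far_iff_coord.1 hx
    have hcoeff : ∀ z : E3, R₁ < ‖z‖ →
        hCoeff e (e.patch D₁ P) z = H z ∧ kCoeff e (e.patch D₁ P) z = HK z := by
      intro z hz
      have hz' : e.R < ‖z‖ := lt_of_le_of_lt P.R_le hz
      have hmem : e.dataChartExt z ∈ e.far R₁ := (e.dataChartExt_mem_far_iff hz').2 hz
      exact ⟨e.hCoeff_eq_of_h_inner_eq_outerField _ hz' (patch_h_inner_of_mem P hmem),
        e.kCoeff_eq_of_k_eq_outerField _ hz' (patch_k_of_mem P hmem)⟩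
    have hO : IsOpen {w : E3 | R₁ < ‖w‖} := isOpen_lt continuous_const continuous_norm
    have hevG : hCoeff e (e.patch D₁ P) =ᶠ[𝓝 (e.coord x)] H := by
      filter_upwards [hO.mem_nhds hxR] with w hw
      exact (hcoeff w hw).1
    have hevK : kCoeff e (e.patch D₁ P) =ᶠ[𝓝 (e.coord x)] HK := by
      filter_upwards [hO.mem_nhds hxR] with w hw
      exact (hcoeff w hw).2
    obtain ⟨hh, hmo⟩ := hcv _ hxR
    refine e.isVacuumAt_of_coordVacuum (e.patch D₁ P) b hxU ⟨?_, fun Z ↦ ?_⟩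
    · rw [MetricCoord.hamAt_congr_of_eventuallyEq hevG hevK]
      exact hh
    · rw [MetricCoord.momFn_congr_of_eventuallyEq b hevG hevK Z]
      exact hmo Z
  · obtain ⟨hh, hk⟩ := patch_eventuallyEq_of_not_mem_far P hx
    haveI := D₁.metric.hasLeviCivita
    have hv : D₁.IsVacuumConstraintSolution := hD₁
    exact (InitialDataSet.isVacuumAt_congr hh hk).2 (hv x)

/-! ### Patched families are jointly smooth -/

/-- **Joint smoothness of patched sections.** Let `(c, z) ↦ H c z` be a family of coordinate fields
(parameters in a real normed space) and `s c` a jointly smooth family of sections of the bundle of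
bilinear forms on `TX`. If `H` is jointly `C^∞` at `(c, coord x)` when `x ∈ e.far R₁`, and
`coord^*(H c') = s c'` on the annulus `{R₁ < ‖coord‖ < ρ₁}` for `c'` in a neighbourhood `Sc` of `c`,
then `(c', y) ↦ patchField e R₁ (coord^*(H c')) (s c') y` is jointly smooth at `(c, x)`: near a
point of the far region it is the outer-field family (`contMDiffAt_outerField_family_of_contDiffAt`),
near a point off `e.closedFar ρ₁` it is `s`. [cite: Corvino2000, §4] -/
theorem contMDiffAt_patchField_outerField_family {P' : Type*} [NormedAddCommGroup P']
    [NormedSpace ℝ P'] (e : AFEnd X) {R₁ ρ₁ : ℝ} (hR₁ : e.R ≤ R₁) (h₁ : R₁ < ρ₁)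
    {H : P' → E3 → E3 →L[ℝ] E3 →L[ℝ] ℝ} {s : P' → BilinField X} {c : P'} {x : X}
    {Sc : Set P'} (hSc : Sc ∈ 𝓝 c)
    (hH : x ∈ e.far R₁ → ContDiffAt ℝ ∞ (uncurry H) (c, e.coord x))
    (hs : ContMDiffAt (𝓘(ℝ, P').prod (𝓡 3)) ((𝓡 3).prod 𝓘(ℝ, E3 →L[ℝ] E3 →L[ℝ] ℝ)) ∞
      (fun q : P' × X ↦ TotalSpace.mk' (E3 →L[ℝ] E3 →L[ℝ] ℝ)
        (E := fun x : X ↦ TangentSpace (𝓡 3) x →L[ℝ] TangentSpace (𝓡 3) x →L[ℝ] ℝ) q.2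
        (s q.1 q.2)) (c, x))
    (hagree : ∀ c' ∈ Sc, ∀ y ∈ e.far R₁, ‖e.coord y‖ < ρ₁ → outerField e (H c') y = s c' y) :
    ContMDiffAt (𝓘(ℝ, P').prod (𝓡 3)) ((𝓡 3).prod 𝓘(ℝ, E3 →L[ℝ] E3 →L[ℝ] ℝ)) ∞
      (fun q : P' × X ↦ TotalSpace.mk' (E3 →L[ℝ] E3 →L[ℝ] ℝ)
        (E := fun x : X ↦ TangentSpace (𝓡 3) x →L[ℝ] TangentSpace (𝓡 3) x →L[ℝ] ℝ) q.2
        (patchField e R₁ (outerField e (H q.1)) (s q.1) q.2)) (c, x) := by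
  have hevc : ∀ᶠ q : P' × X in 𝓝 (c, x), q.1 ∈ Sc :=
    (continuousAt_fst (p := (c, x))).eventually (Filter.eventually_mem_set.2 hSc)
  by_cases hx : x ∈ e.far R₁
  · obtain ⟨hxU, -⟩ := e.mem_far_iff_coord.1 hx
    have hfam := e.contMDiffAt_outerField_family_of_contDiffAt hxU (hH hx)
    refine hfam.congr_of_eventuallyEq ?_
    have hevx : ∀ᶠ q : P' × X in 𝓝 (c, x), q.2 ∈ e.far R₁ :=
      (continuousAt_snd (p := (c, x))).eventually ((e.isOpen_far R₁).eventually_mem hx)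
    filter_upwards [hevx] with q hq
    rw [patchField_of_mem hq]
  · have hx' : x ∈ (e.closedFar ρ₁)ᶜ := e.notMem_closedFar_of_notMem_far h₁ hx
    have hevx : ∀ᶠ q : P' × X in 𝓝 (c, x), q.2 ∈ (e.closedFar ρ₁)ᶜ :=
      (continuousAt_snd (p := (c, x))).eventually
        ((e.isClosed_closedFar (lt_of_le_of_lt hR₁ h₁)).isOpen_compl.eventually_mem hx')
    refine hs.congr_of_eventuallyEq ?_
    filter_upwards [hevc, hevx] with q hqc hqx
    by_cases hq : q.2 ∈ e.far R₁
    · rw [patchField_of_mem hq,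
        hagree q.1 hqc q.2 hq (e.norm_coord_lt_of_not_mem_closedFar (e.far_subset R₁ hq) hqx)]
    · rw [patchField_of_not_mem hq]

/-! ### Reassembly of a far coordinate family -/

/-- **Reassembly: a far coordinate family gives a local gluing family on `X`.** Let `e` be an end
of `X`, `F` a smooth one-parameter family of vacuum data through `D = F 0`, `e.R ≤ R₁ < ρ₁`,
`R₁ ≤ R₂`, `r > 0`, and `(H c, HK c)`, `c ∈ ball 0 r`, coordinate fields on `E3` which at the points
of `ball 0 r × {R₁ < ‖z‖}` are jointly `C^∞`, symmetric, `H c` positive definite and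
coordinate-vacuum (`hamAt = 0`, `momFn = 0`), with `(H 0, HK 0) = (h_ij, k_ij)(D)` beyond `R₁`,
`(H c, HK c) = (h_ij, k_ij)(F c)` on `{R₁ < ‖z‖ < ρ₁}` and `= (h_ij, k_ij)(D)` beyond `R₂`. Then the
patches `G₀ c` of `F c` by the outer fields `coord^*(H c, HK c)` beyond radius `R₁` form a family
of VACUUM initial data sets on `X`, jointly smooth on `ball 0 r × X`, with `G₀ 0 = D`, `G₀ c = F c`
off `e.far R₁` and `G₀ c = D` on `e.far R₂` for `‖c‖ < r` (Chruściel–Delay 2003, Cor. 5.11 and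
§8.6: the solution on the annulus is smoothly continued by the given data on either side).
[cite: ChruscielDelay2003, Cor. 5.11 and §8.6] -/
theorem exists_localGluingFamily_of_farCoordFamily (e : AFEnd X) (D : InitialDataSet (𝓡 3) X)
    (F : EuclideanSpace ℝ (Fin 1) → InitialDataSet (𝓡 3) X)
    (hF : InitialDataSet.IsSmoothDataFamily 1 F) (hF0 : F 0 = D)
    (hFvac : ∀ c, ∀ [(F c).metric.HasLeviCivita], (F c).IsVacuumConstraintSolution)
    {R₁ ρ₁ R₂ r : ℝ} (hR₁ : e.R ≤ R₁) (h₁ : R₁ < ρ₁) (hR₂ : R₁ ≤ R₂) (hr : 0 < r)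
    {ι : Type*} [Fintype ι] (b : Basis ι ℝ E3)
    (H HK : EuclideanSpace ℝ (Fin 1) → E3 → E3 →L[ℝ] E3 →L[ℝ] ℝ)
    (hsm : ∀ c ∈ ball (0 : EuclideanSpace ℝ (Fin 1)) r, ∀ z : E3, R₁ < ‖z‖ →
      ContDiffAt ℝ ∞ (uncurry H) (c, z) ∧ ContDiffAt ℝ ∞ (uncurry HK) (c, z))
    (hsym : ∀ c ∈ ball (0 : EuclideanSpace ℝ (Fin 1)) r, ∀ z : E3, R₁ < ‖z‖ → ∀ v w : E3,
      H c z v w = H c z w v ∧ HK c z v w = HK c z w v)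
    (hpos : ∀ c ∈ ball (0 : EuclideanSpace ℝ (Fin 1)) r, ∀ z : E3, R₁ < ‖z‖ → ∀ v : E3,
      v ≠ 0 → 0 < H c z v v)
    (hcv : ∀ c ∈ ball (0 : EuclideanSpace ℝ (Fin 1)) r, ∀ z : E3, R₁ < ‖z‖ →
      MetricCoord.hamAt (H c) (HK c) z = 0 ∧ ∀ Z : E3, MetricCoord.momFn b (H c) (HK c) z Z = 0)
    (hH0 : ∀ z : E3, R₁ < ‖z‖ → H 0 z = hCoeff e D z ∧ HK 0 z = kCoeff e D z)
    (hin : ∀ c ∈ ball (0 : EuclideanSpace ℝ (Fin 1)) r, ∀ z : E3, R₁ < ‖z‖ → ‖z‖ < ρ₁ →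
      H c z = hCoeff e (F c) z ∧ HK c z = kCoeff e (F c) z)
    (hout : ∀ c ∈ ball (0 : EuclideanSpace ℝ (Fin 1)) r, ∀ z : E3, R₂ < ‖z‖ →
      H c z = hCoeff e D z ∧ HK c z = kCoeff e D z) :
    ∃ G₀ : EuclideanSpace ℝ (Fin 1) → InitialDataSet (𝓡 3) X,
      ContMDiffOn (𝓘(ℝ, EuclideanSpace ℝ (Fin 1)).prod (𝓡 3))
        ((𝓡 3).prod 𝓘(ℝ, E3 →L[ℝ] E3 →L[ℝ] ℝ)) ∞
        (fun p : EuclideanSpace ℝ (Fin 1) × X ↦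
          TotalSpace.mk' (F := E3 →L[ℝ] E3 →L[ℝ] ℝ)
            (E := fun x : X ↦ TangentSpace (𝓡 3) x →L[ℝ] TangentSpace (𝓡 3) x →L[ℝ] ℝ)
            p.2 ((G₀ p.1).h.inner p.2))
        (ball (0 : EuclideanSpace ℝ (Fin 1)) r ×ˢ (univ : Set X)) ∧
      ContMDiffOn (𝓘(ℝ, EuclideanSpace ℝ (Fin 1)).prod (𝓡 3))
        ((𝓡 3).prod 𝓘(ℝ, E3 →L[ℝ] E3 →L[ℝ] ℝ)) ∞
        (fun p : EuclideanSpace ℝ (Fin 1) × X ↦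
          TotalSpace.mk' (F := E3 →L[ℝ] E3 →L[ℝ] ℝ)
            (E := fun x : X ↦ TangentSpace (𝓡 3) x →L[ℝ] TangentSpace (𝓡 3) x →L[ℝ] ℝ)
            p.2 ((G₀ p.1).k p.2))
        (ball (0 : EuclideanSpace ℝ (Fin 1)) r ×ˢ (univ : Set X)) ∧
      G₀ 0 = D ∧
      (∀ c : EuclideanSpace ℝ (Fin 1), ‖c‖ < r →
        ∀ [(G₀ c).metric.HasLeviCivita], (G₀ c).IsVacuumConstraintSolution) ∧
      (∀ c : EuclideanSpace ℝ (Fin 1), ‖c‖ < r → ∀ x ∉ e.far R₁,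
        (G₀ c).h.inner x = (F c).h.inner x ∧ (G₀ c).k x = (F c).k x) ∧
      (∀ c : EuclideanSpace ℝ (Fin 1), ‖c‖ < r → ∀ x ∈ e.far R₂,
        (G₀ c).h.inner x = D.h.inner x ∧ (G₀ c).k x = D.k x) := by
  classical
  -- the patch data for `‖c‖ < r`
  have hP : ∀ c : EuclideanSpace ℝ (Fin 1), ‖c‖ < r →
      e.PatchData (F c) R₁ ρ₁ (outerField e (H c)) (outerField e (HK c)) := by
    intro c hc
    have hc' : c ∈ ball (0 : EuclideanSpace ℝ (Fin 1)) r := mem_ball_zero_iff.2 hc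
    have hpt : ∀ z : E3, ContDiffAt ℝ ∞ (fun w : E3 ↦ (c, w)) z := fun z ↦
      contDiffAt_const.prodMk contDiffAt_id
    exact e.patchData_outerField (F c) hR₁ h₁
      (fun z hz ↦ ⟨(hsm c hc' z hz).1.comp z (hpt z), (hsm c hc' z hz).2.comp z (hpt z)⟩)
      (hsym c hc') (hpos c hc') (hin c hc')
  -- the family: the patch for `‖c‖ < r`, `D` otherwise (only the ball matters)
  let G₀ : EuclideanSpace ℝ (Fin 1) → InitialDataSet (𝓡 3) X := fun c ↦
    if hc : ‖c‖ < r then e.patch (F c) (hP c hc) else D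
  have hG₀ : ∀ (c : EuclideanSpace ℝ (Fin 1)) (hc : ‖c‖ < r), G₀ c = e.patch (F c) (hP c hc) :=
    fun c hc ↦ dif_pos hc
  have hsec : ∀ (c : EuclideanSpace ℝ (Fin 1)) (hc : ‖c‖ < r) (x : X),
      (G₀ c).h.inner x = patchField e R₁ (outerField e (H c)) (F c).h.inner x ∧
        (G₀ c).k x = patchField e R₁ (outerField e (HK c)) (F c).k x := by
    intro c hc x
    rw [hG₀ c hc]
    exact ⟨rfl, rfl⟩
  have hevr : ∀ {c : EuclideanSpace ℝ (Fin 1)} {x : X}, c ∈ ball (0 : EuclideanSpace ℝ (Fin 1)) r →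
      ∀ᶠ q : EuclideanSpace ℝ (Fin 1) × X in 𝓝 (c, x), ‖q.1‖ < r := by
    intro c x hc
    exact ((continuousAt_fst (p := (c, x))).eventually (isOpen_ball.eventually_mem hc)).mono
      fun q hq ↦ mem_ball_zero_iff.1 hq
  -- vacuum, through the patch (the instance is transported along `G₀ c = patch`)
  have hvac : ∀ (c : EuclideanSpace ℝ (Fin 1)) (hc : ‖c‖ < r) (D' : InitialDataSet (𝓡 3) X)
      [D'.metric.HasLeviCivita], D' = e.patch (F c) (hP c hc) → D'.IsVacuumConstraintSolution := by
    rintro c hc D' _ rfl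
    exact e.isVacuumConstraintSolution_patch_outerField (F c) (hP c hc) b
      (hcv c (mem_ball_zero_iff.2 hc)) (hFvac c)
  refine ⟨G₀, ?_, ?_, ?_, fun c hc inst ↦ hvac c hc (G₀ c) (hG₀ c hc), ?_, ?_⟩
  · -- joint smoothness of the metric sections on `ball × X`
    rintro ⟨c, x⟩ ⟨hc, -⟩
    have key := e.contMDiffAt_patchField_outerField_family hR₁ h₁
      (s := fun c' y ↦ (F c').h.inner y) (isOpen_ball.mem_nhds hc)
      (fun hx ↦ (hsm c hc _ (e.mem_far_iff_coord.1 hx).2).1) (hF.1 (c, x))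
      (fun c' hc' y hy hlt ↦ (hP c' (mem_ball_zero_iff.1 hc')).agree_h y hy hlt)
    refine (key.congr_of_eventuallyEq ?_).contMDiffWithinAt
    filter_upwards [hevr hc] with q hq
    rw [(hsec q.1 hq q.2).1]
  · -- joint smoothness of the `k` sections on `ball × X`
    rintro ⟨c, x⟩ ⟨hc, -⟩
    have key := e.contMDiffAt_patchField_outerField_family hR₁ h₁
      (s := fun c' y ↦ (F c').k y) (isOpen_ball.mem_nhds hc)
      (fun hx ↦ (hsm c hc _ (e.mem_far_iff_coord.1 hx).2).2) (hF.2 (c, x))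
      (fun c' hc' y hy hlt ↦ (hP c' (mem_ball_zero_iff.1 hc')).agree_k y hy hlt)
    refine (key.congr_of_eventuallyEq ?_).contMDiffWithinAt
    filter_upwards [hevr hc] with q hq
    rw [(hsec q.1 hq q.2).2]
  · -- `G₀ 0 = D`
    have h0r : ‖(0 : EuclideanSpace ℝ (Fin 1))‖ < r := by simpa using hr
    rw [hG₀ 0 h0r]
    refine InitialDataSet.ext' (fun x v w ↦ ?_) (fun x v w ↦ ?_)
    · by_cases hx : x ∈ e.far R₁
      · obtain ⟨hxU, hxR⟩ := e.mem_far_iff_coord.1 hx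
        rw [patch_h_inner_of_mem _ hx, e.outerField_eq_h_inner D hxU (hH0 _ hxR).1]
      · rw [patch_h_inner_of_not_mem _ hx, hF0]
    · by_cases hx : x ∈ e.far R₁
      · obtain ⟨hxU, hxR⟩ := e.mem_far_iff_coord.1 hx
        rw [patch_k_of_mem _ hx, e.outerField_eq_k D hxU (hH0 _ hxR).2]
      · rw [patch_k_of_not_mem _ hx, hF0]
  · -- `= F c` off `e.far R₁`
    intro c hc x hx
    rw [hG₀ c hc]
    exact patch_eq_of_not_mem_far _ hx
  · -- `= D` on `e.far R₂`
    intro c hc x hx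
    have hc' : c ∈ ball (0 : EuclideanSpace ℝ (Fin 1)) r := mem_ball_zero_iff.2 hc
    obtain ⟨hxU, hxR⟩ := e.mem_far_iff_coord.1 hx
    have hx₁ : x ∈ e.far R₁ := e.far_mono hR₂ hx
    rw [hG₀ c hc, patch_h_inner_of_mem _ hx₁, patch_k_of_mem _ hx₁]
    exact ⟨e.outerField_eq_h_inner D hxU (hout c hc' _ hxR).1,
      e.outerField_eq_k D hxU (hout c hc' _ hxR).2⟩

end AFEnd

end Literature.Geometry.Lorentzian

end
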